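import Mathlib
import HarnessLib
import Literature.Analysis.FluidPDE.Tao2016AveragedNS.LocalCascadeSolutions
import Literature.Analysis.FluidPDE.Tao2016AveragedNS.RenormalisedCascadeWaves
import Summits.NavierStokesRegularity.NavierStokesRegularity.Theorems.TaoLadderRungTwoBreakEternalRigidityViscBddOneDefs
import Summits.NavierStokesRegularity.NavierStokesRegularity.Theorems.TaoLadderRungTwoBreakEternalRigidityViscBddOneFiringFloor
import Summits.NavierStokesRegularity.NavierStokesRegularity.Theorems.TaoLadderRungTwoBreakEternalRigidityViscBddOneDissipationLedger
import Summits.NavierStokesRegularity.NavierStokesRegularity.Theorems.TaoLadderRungTwoBreakEternalRigidityViscBddOneRiseDissipation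

/-!
# Crux `TaoLadderRungTwoBreak.EternalRigidityViscBddOne` (stmt-NavierStokesRegularity-20420): the LOUDNESS BUDGET of a regular viscous
# trajectory — `3ν · Σ_{1≤n≤M} λ^{2n} a_n³ / λ^{5n/2} ≤ 2048 (Σ_i X₀ᵢ²)²` for any levels `a_n` the shells reach (no blow-up assumed)

MODEL lattice ODEs only (Tao 2016 §4: the exact NS-scaled `ν`-viscous cascade lattice of a table of `InTableClass R`, `m = 4`, from a
one-shell datum; registered vocabulary `ViscousUpTo` of the skeleton `85fbfe8e90eea58b`); nothing here is a statement about the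
Navier–Stokes equations; no stub, crux or summit is closed (`--supports stmt-NavierStokesRegularity-20420`).  `λ = 1+ε₀`, `S = Σ_i X₀ᵢ²`.

The general form of the ledger behind `…ReynoldsThreshold` (which fed it the firing levels `a_n² = c₀ν²λ^{−n}` of a blow-up): the
per-shell rise-time dissipation (`RiseDissipation.rise_dissipation`: a shell empty at `t = 0` that reaches `‖X_n‖² ≥ a_n²` has
`3a_n³ ≤ 4096 λ^{5n/2} S ∫‖X_n‖²`) summed against the summed dissipation budget (`DissipationLedger.dissipation_budget_finset_sum_window`:
`Σ_n νλ^{2n}∫‖X_n‖² ≤ S/2`) gives, for EVERY regular trajectory and ANY levels reached,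

* `loudness_budget` (clause form) / `loudness_budget_of_viscousUpTo` (registered vocabulary):
  `3ν · Σ_{n=1}^{M} λ^{2n} λ^{−5n/2} a_n³ ≤ 2048 S²`.

READING: an ℓ³-type a-priori bound on the PEAK PROFILE `a_n = sup_t ‖X_n(t)‖` of the cascade, `Σ_n λ^{−n/2} a_n³ ≲ S²/ν`: a front can cross
at most `≈ 683 S^{1/2}/ν` consecutive low shells at full amplitude `a_n ≈ S^{1/2}` — at scale ratio `1+ε₀` that is a wavenumber range of at most
`(1+ε₀)^{683 √S/ν} → 1` as `ε₀ → 0` with the Reynolds number fixed (an inertial-range bound, weak but rigorous and table-independent); with the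
firing levels of a blow-up it is the Reynolds-threshold divergence of `…ReynoldsThreshold`.
HONEST LABEL: a-priori estimate; (ω3) `stub_typeOne`, (ω4) `stub_eternalLimitViscBdd`, ⟨20420⟩ and every NS statement remain OPEN; rung 0.
-/

noncomputable section

-- the summit and its single sub-problem share the name (CONVENTIONS §1)
set_option linter.dupNamespace false

namespace Summit.NavierStokesRegularity.NavierStokesRegularity.Theorems.EternalRigidityViscBddOne.LoudnessBudget

open Set Filter Topology MeasureTheory
open Literature.Analysis.FluidPDE Literature.Analysis.FluidPDE.TaoCascade
open Summit.NavierStokesRegularity.NavierStokesRegularity.Theorems.MinimalViscousBlowup.ThresholdRay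
open Summit.NavierStokesRegularity.NavierStokesRegularity.Theorems.EternalRigidityViscBddOne.Birth
open Summit.NavierStokesRegularity.NavierStokesRegularity.Theorems.EternalRigidityViscBddOne.FiringFloor
open Summit.NavierStokesRegularity.NavierStokesRegularity.Theorems.EternalRigidityViscBddOne.DissipationLedger
open Summit.NavierStokesRegularity.NavierStokesRegularity.Theorems.EternalRigidityViscBddOne.RiseDissipation

/-- A window `(0,T']`, `T' < T`, containing the reaching times of the shells `1, …, M`. [folklore] -/
theorem exists_window_Icc {T : ℝ} (hT : 0 < T) (t : ℕ → ℝ) (ht : ∀ n, t n < T) (M : ℕ) :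
    ∃ T' : ℝ, 0 < T' ∧ T' < T ∧ ∀ n, n ≤ M → t n ≤ T' := by
  induction M with
  | zero =>
    refine ⟨max (T / 2) (t 0), lt_max_of_lt_left (by linarith), max_lt (by linarith) (ht 0), fun n hn => ?_⟩
    rw [Nat.le_zero.1 hn]; exact le_max_right _ _
  | succ M ih =>
    obtain ⟨T', hT'0, hT'T, hle⟩ := ih
    refine ⟨max T' (t (M + 1)), lt_max_of_lt_left hT'0, max_lt hT'T (ht (M + 1)), fun n hn => ?_⟩
    rcases Nat.lt_or_ge n (M + 1) with h | h
    · exact (hle n (by omega)).trans (le_max_left _ _)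
    · have hnM : n = M + 1 := by omega
      rw [hnM]; exact le_max_right _ _

/-- **THE LOUDNESS BUDGET (clause form).**  Cancelling table of `InTableClass R`; a regular trajectory of the `ν`-viscous lattice (`ν > 0`) on
`[0,T)` from the one-shell datum `X₀` (shells below `0` empty at all times, (4.5)-regular on every `[0,T']`).  If the shells `1 ≤ n ≤ M`
reach the levels `‖X_n(t_n)‖² ≥ a_n²` (`a_n > 0`) at times `t_n < T`, then `3ν · Σ_{n=1}^{M} λ^{2n} λ^{−5n/2} a_n³ ≤ 2048 (Σ_i X₀ᵢ²)²`.
[cite: Tao2016AveragedNS, §4 (4.3), Lemma 4.1 (4.5), (4.11), proof of (4.13), the viscous equation before Thm. 4.2] -/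
theorem loudness_budget {ε₀ R ν T : ℝ} (hε : 0 < ε₀) (hν : 0 < ν) (hT : 0 < T)
    {α : Fin 4 → Fin 4 → Fin 4 → ℤ × ℤ × ℤ → ℝ} (hα : InTableClass R α)
    {X₀ : Fin 4 → ℝ} {X : Fin 4 → ℤ → ℝ → ℝ}
    (hcd : ∀ i n, ContDiffOn ℝ 1 (X i n) (Ico 0 T))
    (hinit : ∀ i n, X i n 0 = if n = 0 then X₀ i else 0)
    (hlow : ∀ i n t, n < 0 → X i n t = 0)
    (hmot : ∀ i n t, 0 ≤ t → t < T → derivWithin (X i n) (Ici 0) t =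
      quadTerm ε₀ α X i n t - ν * (1 + ε₀) ^ ((2 : ℝ) * n) * X i n t)
    (hreg : ∀ T' : ℝ, 0 < T' → T' < T → ∃ M : ℝ, ∀ t : ℝ, 0 ≤ t → t ≤ T' →
      ∀ (i : Fin 4) (n : ℤ), (1 + (1 + ε₀) ^ ((10 : ℝ) * n)) * |X i n t| ≤ M)
    (M : ℕ) (a : ℕ → ℝ) (ha : ∀ n, 0 < a n)
    (hreach : ∀ n : ℕ, 1 ≤ n → n ≤ M → ∃ t : ℝ, 0 ≤ t ∧ t < T ∧ a n ^ 2 ≤ ‖shellVec X n t‖ ^ 2) :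
    3 * ν * ∑ n ∈ Finset.Icc 1 M, (1 + ε₀) ^ (2 * n) / (1 + ε₀) ^ ((5 : ℝ) * n / 2) * a n ^ 3 ≤
      2048 * (∑ i : Fin 4, X₀ i ^ 2) ^ 2 := by
  have hl0 : (0 : ℝ) < 1 + ε₀ := by linarith
  have hcan : IsCancellingCoeff α := hα.2.1
  have hα1 : ∀ i₁ i₂ i₃ : Fin 4, |α i₁ i₂ i₃ (0, 0, 1)| ≤ 1 := fun i₁ i₂ i₃ =>
    abs_le_one_of_inTableClass hα i₁ i₂ i₃ _ (by rw [mem_shiftSet_iff]; simp)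
  have hE := shellEnergy_le_datum hε hν.le hcan hα1 hcd hinit hlow hmot hreg
  set S : ℝ := ∑ i : Fin 4, X₀ i ^ 2 with hSdef
  have hS0 : 0 ≤ S := Finset.sum_nonneg fun i _ => sq_nonneg _
  -- reaching times (dummy `0` outside `1 ≤ n ≤ M`) and a common window
  have hreach' : ∀ n : ℕ, ∃ t : ℝ, 0 ≤ t ∧ t < T ∧ (1 ≤ n → n ≤ M → a n ^ 2 ≤ ‖shellVec X n t‖ ^ 2) := by
    intro n
    by_cases h : 1 ≤ n ∧ n ≤ M
    · obtain ⟨t, ht0, htT, hle⟩ := hreach n h.1 h.2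
      exact ⟨t, ht0, htT, fun _ _ => hle⟩
    · exact ⟨0, le_rfl, hT, fun h1 h2 => absurd ⟨h1, h2⟩ h⟩
  choose t ht0 htT htreach using hreach'
  obtain ⟨T', hT'0, hT'T, htle⟩ := exists_window_Icc hT t htT M
  -- per shell: `3ν λ^{2n} a_n³ / λ^{5n/2} ≤ 4096 S · (ν λ^{2n} ∫ ‖X_n‖²)`
  set f : ℕ → ℝ := fun k => ν * (1 + ε₀) ^ (2 * k) * ∫ s in Ioc 0 T', ‖shellVec X k s‖ ^ 2 with hf
  have hf0 : ∀ k, 0 ≤ f k := fun k => by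
    rw [hf]; dsimp only
    exact mul_nonneg (by positivity) (setIntegral_nonneg measurableSet_Ioc fun s _ => sq_nonneg _)
  have hshell : ∀ n ∈ Finset.Icc 1 M,
      3 * ν * ((1 + ε₀) ^ (2 * n) / (1 + ε₀) ^ ((5 : ℝ) * n / 2) * a n ^ 3) ≤ 4096 * S * f n := by
    intro n hn
    rw [Finset.mem_Icc] at hn
    set w : ℝ := (1 + ε₀) ^ ((5 : ℝ) * n / 2) with hw
    have hw0 : 0 < w := Real.rpow_pos_of_pos hl0 _
    have hn0 : ∀ i : Fin 4, X i (n : ℤ) 0 = 0 := fun i => by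
      rw [hinit, if_neg (by omega)]
    have hrise := rise_dissipation hε hν.le hcan hα1 hcd hmot hE n hn0 (le_refl w) (ha n) (ht0 n)
      (htle n hn.2) hT'T (htreach n hn.1 hn.2)
    -- `hrise : 3 a³ ≤ 4096 w S I`
    set I : ℝ := ∫ s in Ioc 0 T', ‖shellVec X (n : ℤ) s‖ ^ 2 with hI
    have hl2n : 0 < (1 + ε₀) ^ (2 * n) := by positivity
    rw [hf]; dsimp only
    rw [div_mul_eq_mul_div, mul_div_assoc']
    rw [div_le_iff₀ hw0]
    calc 3 * ν * ((1 + ε₀) ^ (2 * n) * a n ^ 3) = (ν * (1 + ε₀) ^ (2 * n)) * (3 * a n ^ 3) := by ring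
      _ ≤ (ν * (1 + ε₀) ^ (2 * n)) * (4096 * w * S * I) := mul_le_mul_of_nonneg_left hrise (by positivity)
      _ = 4096 * S * (ν * (1 + ε₀) ^ (2 * n) * I) * w := by ring
  -- sum and compare with the summed budget over `k < M + 1`
  have hbudget := dissipation_budget_finset_sum_window hε hν hcan hα1 hcd hinit (fun i n s hn _ => hlow i n s hn)
    hmot hreg hT'0 hT'T (M + 1)
  have hS2 : ∑ i : Fin 4, (1 / 2 : ℝ) * X₀ i ^ 2 = S / 2 := by
    rw [hSdef, Finset.sum_div]
    exact Finset.sum_congr rfl fun i _ => by ring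
  rw [hS2] at hbudget
  have hsub : Finset.Icc 1 M ⊆ Finset.range (M + 1) := by
    intro k hk
    rw [Finset.mem_Icc] at hk
    rw [Finset.mem_range]
    omega
  have hsubsum : ∑ n ∈ Finset.Icc 1 M, f n ≤ ∑ k ∈ Finset.range (M + 1), f k :=
    Finset.sum_le_sum_of_subset_of_nonneg hsub fun k _ _ => hf0 k
  calc 3 * ν * ∑ n ∈ Finset.Icc 1 M, (1 + ε₀) ^ (2 * n) / (1 + ε₀) ^ ((5 : ℝ) * n / 2) * a n ^ 3
      = ∑ n ∈ Finset.Icc 1 M, 3 * ν * ((1 + ε₀) ^ (2 * n) / (1 + ε₀) ^ ((5 : ℝ) * n / 2) * a n ^ 3) := by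
        rw [Finset.mul_sum]
    _ ≤ ∑ n ∈ Finset.Icc 1 M, 4096 * S * f n := Finset.sum_le_sum hshell
    _ = 4096 * S * ∑ n ∈ Finset.Icc 1 M, f n := (Finset.mul_sum (Finset.Icc 1 M) f (4096 * S)).symm
    _ ≤ 4096 * S * ∑ k ∈ Finset.range (M + 1), f k := mul_le_mul_of_nonneg_left hsubsum (by positivity)
    _ ≤ 4096 * S * (S / 2) := mul_le_mul_of_nonneg_left hbudget (by positivity)
    _ = 2048 * S ^ 2 := by ring

/-- **THE LOUDNESS BUDGET in the skeleton's vocabulary.**  For every `ε₀ > 0`, every table of `InTableClass R`, every `ν > 0`, every one-shell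
datum `X₀` and every regular trajectory of the exact `ν`-viscous NS-scaled lattice on `[0, t⋆)` (`ViscousUpTo ε₀ ν α X₀ X t⋆`; blow-up or
not): if the shells `1 ≤ n ≤ M` reach the levels `‖X_n(t_n)‖² ≥ a_n²` (`a_n > 0`) before `t⋆`, then
`3ν · Σ_{n=1}^{M} λ^{2n} λ^{−5n/2} a_n³ ≤ 2048 (Σ_i X₀ᵢ²)²` — the peak profile of the cascade is `ℓ³`-small in units of `S²/ν`.
[cite: Tao2016AveragedNS, §4 (4.3), Lemma 4.1 (4.5), (4.11), proof of (4.13), the viscous equation before Thm. 4.2; cell vocabulary] -/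
theorem loudness_budget_of_viscousUpTo {R ε₀ ν : ℝ} (hε₀ : 0 < ε₀) (hν : 0 < ν)
    {α : Fin 4 → Fin 4 → Fin 4 → ℤ × ℤ × ℤ → ℝ} {X₀ : Fin 4 → ℝ} (hα : InTableClass R α)
    {X : Fin 4 → ℤ → ℝ → ℝ} {tStar : ℝ} (hV : ViscousUpTo ε₀ ν α X₀ X tStar)
    (M : ℕ) (a : ℕ → ℝ) (ha : ∀ n, 0 < a n)
    (hreach : ∀ n : ℕ, 1 ≤ n → n ≤ M → ∃ t : ℝ, 0 ≤ t ∧ t < tStar ∧ a n ^ 2 ≤ ‖shellVec X n t‖ ^ 2) :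
    3 * ν * ∑ n ∈ Finset.Icc 1 M, (1 + ε₀) ^ (2 * n) / (1 + ε₀) ^ ((5 : ℝ) * n / 2) * a n ^ 3 ≤
      2048 * (∑ i : Fin 4, X₀ i ^ 2) ^ 2 := by
  have hT : 0 < tStar := hV.pos
  obtain ⟨Z, hZX, hcdZ, hinitZ, hlowZ, hmotZ, hregZ⟩ := zeroNeg_clauses hV
  have hreachZ : ∀ n : ℕ, 1 ≤ n → n ≤ M → ∃ t : ℝ, 0 ≤ t ∧ t < tStar ∧ a n ^ 2 ≤ ‖shellVec Z n t‖ ^ 2 := by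
    intro n h1 h2
    obtain ⟨t, ht0, htT, hle⟩ := hreach n h1 h2
    have hsv : shellVec Z n t = shellVec X n t := by
      ext j; rw [shellVec_apply, shellVec_apply, hZX j n t ht0 htT]
    exact ⟨t, ht0, htT, by rw [hsv]; exact hle⟩
  exact loudness_budget hε₀ hν hT hα hcdZ hinitZ hlowZ hmotZ hregZ M a ha hreachZ

end Summit.NavierStokesRegularity.NavierStokesRegularity.Theorems.EternalRigidityViscBddOne.LoudnessBudget

end
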